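import Summits.NavierStokesRegularity.NavierStokesRegularity.Theorems.EulerZoomLiouvillePowerGaugeEulerLiouvilleNeedleSphereGrowthTools
import Summits.NavierStokesRegularity.NavierStokesRegularity.Theorems.EulerZoomLiouvillePowerGaugeEulerLiouvilleNeedleGradientGrowthTools
import Summits.NavierStokesRegularity.NavierStokesRegularity.Theorems.EulerZoomLiouvillePowerGaugeEulerLiouvilleNeedleThinCoreMember
import Summits.NavierStokesRegularity.NavierStokesRegularity.Theorems.EulerZoomLiouvillePowerGaugeEulerLiouvilleSelfSimilarPiercingSpheres
import HarnessLib

/-!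
# The needle's price, sphere by sphere: gradient growth forced by fast spheres (plate S4b of ROUND-36)

Support toward `stmt-NavierStokesRegularity-19832` (`PowerGaugeEulerLiouville`, THE ONE STATEMENT
`Sig.stub_selfSimilarC2Needle`, skeleton v48).  The complement of `HasBernoulliPiercing ρ V` supplies a `γ`-FAST POINT
`⟪y, V y⟫ ≤ −γ‖y‖²`, `γ = 1/(2+ρ)`, on EVERY sphere `S_R`, `R ≥ R₀`.  This file prices that, at the level of the profile
and with no Euler content:

* `gradient_growth_of_fastSpheres` — for a `C¹` profile with the A-growth `∫_{B_L}|V|² ≤ cL^{1−2ρ}` and the E-weight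
  `∫‖∇V‖²‖y‖^{ρ−1} ≤ C` (the outputs of `NeedleThinCore.selfSimilar_needle_inputs`), a `γ`-fast point on every sphere
  beyond `R₀` forces, for every `L ≥ L₀(ρ, c, C, γ, R₀)`,
  `sup_{B_{3L}} ‖∇V‖ ≥ (γ/3)·exp(β L^{2+ρ})`, `β = 19πγ²/(51200(2(c+1)+8C))`.
  Mechanism (ROUND-36 §4): slice the shell `L < ‖y‖ < 2L` by SPHERES; the six-cone pigeonhole
  (`NeedleSphereThinness.exists_cone_radii`) and the good-radius selection with the whole-ball budgets give a sphere `S_t`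
  carrying a fast point inside a fixed chart cone on which every `(γ/2)t²`-core cap of the flux observable `−⟪y, V y⟫`
  is exponentially thin (`NeedleSphereThinness.exists_thin_sphere`); but `‖∇V‖ ≤ G` on `B_{3L}` makes the cap of radius
  `≍ γL/G` around the fast point such a core (`NeedleSphereGrowth.chart_core`), whence `γL/G ≲ t·exp(−βL^{2+ρ})`.
* `exists_sphere_without_fast_point_of_expGradient` — COROLLARY: a profile whose gradient has exponential order
  `σ < 2+ρ`, `‖∇V(y)‖ ≤ K·exp(B(1+‖y‖)^σ)`, has beyond every radius a sphere WITHOUT `γ`-fast points.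
* `selfSimilar_ae_eq_zero_of_expGradient` — MEMBER LEVEL: an exactly self-similar member of Seregin's power-gauged
  class (`0 < ρ ≤ 1/2`) with `C²` profile of gradient exponential order `< 2+ρ` is trivial, by
  `Loc.selfSimilar_ae_eq_zero_of_piercingIrrotationalC2_profile` (its sphere hypothesis holds vacuously).
  This strictly widens `NeedleGradientGrowth.selfSimilar_ae_eq_zero_of_polyGradient` (polynomial order `q < 2+ρ`):
  sphere slicing makes the thinness exponent `≍ γ²L^{2+ρ}` independent of the gradient bound.

[folklore: Chebyshev + coarea-free good-radius selection + logarithmic capacity on caps]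
-/

set_option linter.dupNamespace false

open MeasureTheory Set Filter Topology Metric Function Real
open scoped RealInnerProductSpace ENNReal NNReal

namespace Summit.NavierStokesRegularity.NavierStokesRegularity.Theorems.PowerGaugeEulerLiouville.NeedleSphereGrowth

open NeedleDiscChart NeedleSphereChart NeedleThinness NeedleSphereThinness Literature.Analysis Literature.Analysis.FluidPDE

section Profile

variable {V : EuclideanSpace ℝ (Fin 3) → EuclideanSpace ℝ (Fin 3)}

/-- **GRADIENT GROWTH FORCED BY FAST SPHERES (profile level).**  `C¹` profile with A-growth `∫_{B_L}|V|² ≤ cL^{1−2ρ}`,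
E-weight `∫‖∇V‖²‖y‖^{ρ−1} ≤ C`, `0 < ρ < 1`, and a `γ`-fast point `⟪y, V y⟫ ≤ −γ‖y‖²` on every sphere `S_R`, `R ≥ R₀`:
then for all `L ≥ L₀` every gradient bound `G` on `B_{3L}` satisfies `(γ/3)·exp(βL^{2+ρ}) ≤ G`,
`β = 19πγ²/(51200(2(c+1)+8C))`. [folklore] -/
theorem gradient_growth_of_fastSpheres {ρ : ℝ} (hρ : 0 < ρ) (hρ1 : ρ < 1) {c : ℝ≥0} {C : ℝ} (hC : 0 < C)
    (hV : ContDiff ℝ 1 V)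
    (hA : ∀ L : ℝ, 0 < L → ∫⁻ y in ball (0 : EuclideanSpace ℝ (Fin 3)) L, ‖V y‖ₑ ^ 2 ≤
      (c : ℝ≥0∞) * ENNReal.ofReal (L ^ (1 - 2 * ρ)))
    (hE : ∫⁻ y, ‖fderiv ℝ V y‖ₑ ^ 2 * ENNReal.ofReal (‖y‖ ^ (ρ - 1)) ≤ ENNReal.ofReal C)
    {γ R₀ : ℝ} (hγ : 0 < γ)
    (hfast : ∀ R : ℝ, R₀ ≤ R → ∃ y : EuclideanSpace ℝ (Fin 3), ‖y‖ = R ∧ ⟪y, V y⟫ ≤ -(γ * ‖y‖ ^ 2)) :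
    ∃ L₀ : ℝ, 0 < L₀ ∧ ∀ L : ℝ, L₀ ≤ L → ∀ G : ℝ, 0 < G →
      (∀ x ∈ ball (0 : EuclideanSpace ℝ (Fin 3)) (3 * L), ‖fderiv ℝ V x‖ ≤ G) →
      γ / 3 * Real.exp (19 * π * γ ^ 2 / (51200 * (2 * ((c : ℝ) + 1) + 8 * C)) * L ^ (2 + ρ)) ≤ G := by
  have hβ0 : 0 < 19 * π * γ ^ 2 / (51200 * (2 * ((c : ℝ) + 1) + 8 * C)) := by positivity
  refine ⟨max (max 1 R₀) (max (72000 * ((c : ℝ) + 1) / γ ^ 2)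
    (1 / (19 * π * γ ^ 2 / (51200 * (2 * ((c : ℝ) + 1) + 8 * C))))),
    lt_of_lt_of_le one_pos ((le_max_left _ _).trans (le_max_left _ _)), fun L hL G hG0 hG => ?_⟩
  have hL1 : 1 ≤ L := ((le_max_left _ _).trans (le_max_left _ _)).trans hL
  have hLR : R₀ ≤ L := ((le_max_right _ _).trans (le_max_left _ _)).trans hL
  have hLA : 72000 * ((c : ℝ) + 1) / γ ^ 2 ≤ L := ((le_max_left _ _).trans (le_max_right _ _)).trans hL
  have hLβ : 1 / (19 * π * γ ^ 2 / (51200 * (2 * ((c : ℝ) + 1) + 8 * C))) ≤ L :=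
    ((le_max_right _ _).trans (le_max_right _ _)).trans hL
  have hL0 : 0 < L := by linarith
  have hLc : 24 * ((c : ℝ) + 1) / γ ^ 2 ≤ L :=
    le_trans (div_le_div_of_nonneg_right (by nlinarith [NNReal.coe_nonneg c]) (sq_nonneg γ)) hLA
  -- derivative data
  have hVd : Differentiable ℝ V := hV.differentiable one_ne_zero
  have hVc : Continuous V := hV.continuous
  have hV' : ∀ y, HasFDerivAt V (fderiv ℝ V y) y := fun y => (hVd y).hasFDerivAt
  have hV'c : Continuous (fderiv ℝ V) := hV.continuous_fderiv one_ne_zero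
  -- the closed set of fast points meets every sphere of radius in `(L, 2L)`
  have hFc : IsClosed {y : EuclideanSpace ℝ (Fin 3) | ⟪y, V y⟫ ≤ -(γ * ‖y‖ ^ 2)} :=
    isClosed_le (continuous_id.inner hVc) ((continuous_const.mul (continuous_norm.pow 2)).neg)
  have hfastI : ∀ t ∈ Ioo L (2 * L), ∃ y ∈ {y : EuclideanSpace ℝ (Fin 3) | ⟪y, V y⟫ ≤ -(γ * ‖y‖ ^ 2)}, ‖y‖ = t :=
    fun t ht => by
      obtain ⟨y, hy, hyf⟩ := hfast t (hLR.trans ht.1.le)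
      exact ⟨y, hyf, hy⟩
  -- a chart cone carrying fast points on a set of radii of measure `≥ L/6`
  obtain ⟨u₁, u₂, hon0⟩ := NeedleGradientGrowth.exists_orthonormal_frame (e := EuclideanSpace.single 0 (1 : ℝ))
    (by simp)
  obtain ⟨e, e₁, e₂, hon, hTm, hTI, hTvol⟩ := exists_cone_radii hon0 hFc hL0 hfastI
  -- the whole-ball budgets at radius `2L`
  have h2L : 0 < 2 * L := by linarith
  have h𝓐0 : 0 < ((c : ℝ) + 1) * (2 * L) ^ (1 - 2 * ρ) := by positivity
  have h𝓔0 : 0 < (2 * L) ^ (1 - ρ) * C := by positivity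
  have hA2 : ∫⁻ y in ball (0 : EuclideanSpace ℝ (Fin 3)) (2 * L), ‖V y‖ₑ ^ 2 ≤
      ENNReal.ofReal (((c : ℝ) + 1) * (2 * L) ^ (1 - 2 * ρ)) := by
    refine (hA (2 * L) h2L).trans ?_
    rw [ENNReal.ofReal_mul (by positivity)]
    refine mul_le_mul_of_nonneg_right ?_ bot_le
    rw [← ENNReal.ofReal_coe_nnreal]
    exact ENNReal.ofReal_le_ofReal (by linarith)
  have hE2 : ∫⁻ y in ball (0 : EuclideanSpace ℝ (Fin 3)) (2 * L), ‖fderiv ℝ V y‖ₑ ^ 2 ≤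
      ENNReal.ofReal ((2 * L) ^ (1 - ρ) * C) := by
    refine (NeedleThinCore.lintegral_ball_fderiv_sq_le_of_opWeight hρ1 hE h2L).trans (le_of_eq ?_)
    rw [ENNReal.ofReal_mul (Real.rpow_nonneg h2L.le _)]
  -- the thin sphere, its fast point `y` in the cone, and the chart centre `z₀`
  obtain ⟨t, htT, hthin⟩ := exists_thin_sphere hV' hV'c hon hL0 (half_pos hγ) h𝓔0 h𝓐0 hE2 hA2 hTm hTI hTvol
  obtain ⟨htI, y, hyF, hyt, hyc, hys⟩ := exists_of_mem_coneRadii htT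
  have hyf : ⟪y, V y⟫ ≤ -(γ * ‖y‖ ^ 2) := hyF
  have htpos : 0 < t := hL0.trans htI.1
  have hΦ : sphereChart e e₁ e₂ t (transverseCoord e₁ e₂ y) = y := by
    rw [← hyt]; exact sphereChart_transverseCoord hon hys
  have hz₀ : ‖transverseCoord e₁ e₂ y‖ ≤ 41 / 50 * t := by
    have h1 := norm_transverseCoord_sq_le hon hyc
    rw [hyt] at h1
    refine (pow_le_pow_iff_left₀ (norm_nonneg _) (by positivity) two_ne_zero).1 ?_
    have hsq : (41 / 50 * t) ^ 2 = 1681 / 2500 * t ^ 2 := by ring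
    rw [hsq]
    nlinarith
  -- Case 1: the value at the fast point is below `G L`
  have hVy : ‖V y‖ < G * L := fast_value_lt hVd hρ.le (hA (3 * L) (by linarith)) hγ hL1 hLc hG htI hyt hyf
  -- radii: `η = min(L/2, γL/(7G))`, `w = min((10/23)η, t/25)`, chart disc radius `δ = 2t/25`
  set η : ℝ := min (L / 2) (γ * L / (7 * G)) with hη
  set w : ℝ := min (10 / 23 * η) (t / 25) with hw
  have hη0 : 0 < η := lt_min (by linarith) (by positivity)
  have hw0 : 0 < w := lt_min (by positivity) (by positivity)
  have hwt : w ≤ t / 25 := min_le_right _ _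
  have hwη : 23 / 10 * w ≤ η := by
    have h : w ≤ 10 / 23 * η := min_le_left _ _
    linarith
  have hηL : η ≤ L / 2 := min_le_left _ _
  have hηG : 7 * (η * G) ≤ γ * L := by
    have h : η ≤ γ * L / (7 * G) := min_le_right _ _
    rw [le_div_iff₀ (by positivity)] at h
    linarith
  have hδ : ‖transverseCoord e₁ e₂ y‖ + 2 / 25 * t ≤ 9 / 10 * t := by linarith
  have hwδ : w < 2 / 25 * t := by linarith
  have hbudget := aux_budget (ρ := ρ) (NNReal.coe_nonneg c) hγ hρ.le hL1 hLA htI hw0.le hwt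
  have hcore := chart_core hVd hon hγ.le hL0 hG hG0.le htI hyt hyf hVy.le hηL hηG hz₀ hΦ hwt hwη
  -- the thinness bound with exponent `≥ β L^{2+ρ}`
  have hthin' := hthin (transverseCoord e₁ e₂ y) (2 / 25 * t) w hδ hw0 hwδ hbudget hcore
  have hexp := aux_exponent (C := C) (NNReal.coe_nonneg c) hC hγ hρ.le hL1 htI.1
  have hthin'' : w ≤ 2 / 25 * t *
      Real.exp (-(19 * π * γ ^ 2 / (51200 * (2 * ((c : ℝ) + 1) + 8 * C)) * L ^ (2 + ρ))) :=
    hthin'.trans (mul_le_mul_of_nonneg_left (Real.exp_le_exp.2 (neg_le_neg hexp)) (by positivity))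
  -- `exp(−βL^{2+ρ}) < 1/2` since `βL^{2+ρ} ≥ βL ≥ 1`
  have hE2' : Real.exp (-(19 * π * γ ^ 2 / (51200 * (2 * ((c : ℝ) + 1) + 8 * C)) * L ^ (2 + ρ))) < 1 / 2 := by
    have hL2 : L ≤ L ^ (2 + ρ) := by
      have h := Real.rpow_le_rpow_of_exponent_le hL1 (show (1 : ℝ) ≤ 2 + ρ by linarith)
      rwa [Real.rpow_one] at h
    have h1 : 1 ≤ 19 * π * γ ^ 2 / (51200 * (2 * ((c : ℝ) + 1) + 8 * C)) * L := by
      rw [div_le_iff₀ hβ0] at hLβ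
      linarith
    have h2 : 19 * π * γ ^ 2 / (51200 * (2 * ((c : ℝ) + 1) + 8 * C)) * L ≤
        19 * π * γ ^ 2 / (51200 * (2 * ((c : ℝ) + 1) + 8 * C)) * L ^ (2 + ρ) :=
      mul_le_mul_of_nonneg_left hL2 hβ0.le
    have h3 : (2 : ℝ) < Real.exp 1 := by linarith [Real.exp_one_gt_d9]
    calc Real.exp (-(19 * π * γ ^ 2 / (51200 * (2 * ((c : ℝ) + 1) + 8 * C)) * L ^ (2 + ρ)))
        ≤ Real.exp (-1) := Real.exp_le_exp.2 (by linarith)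
      _ < 1 / 2 := by
          rw [Real.exp_neg, inv_lt_comm₀ (Real.exp_pos 1) (by norm_num)]
          norm_num
          exact h3
  exact aux_contra hγ hL0 hG0 htI hη hw hE2' hthin''

/-- **COROLLARY — exponential order `< 2+ρ` of the gradient leaves spheres without fast points.**  Under the hypotheses
of `gradient_growth_of_fastSpheres` on the profile, if `‖∇V(y)‖ ≤ K·exp(B(1+‖y‖)^σ)` with `B ≥ 0`, `0 ≤ σ < 2+ρ`, then
beyond every radius there is a sphere with no `γ`-fast point. [folklore] -/
theorem exists_sphere_without_fast_point_of_expGradient {ρ : ℝ} (hρ : 0 < ρ) (hρ1 : ρ < 1) {c : ℝ≥0} {C : ℝ}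
    (hC : 0 < C) (hV : ContDiff ℝ 1 V)
    (hA : ∀ L : ℝ, 0 < L → ∫⁻ y in ball (0 : EuclideanSpace ℝ (Fin 3)) L, ‖V y‖ₑ ^ 2 ≤
      (c : ℝ≥0∞) * ENNReal.ofReal (L ^ (1 - 2 * ρ)))
    (hE : ∫⁻ y, ‖fderiv ℝ V y‖ₑ ^ 2 * ENNReal.ofReal (‖y‖ ^ (ρ - 1)) ≤ ENNReal.ofReal C)
    {K B σ : ℝ} (hB : 0 ≤ B) (hσ0 : 0 ≤ σ) (hσ : σ < 2 + ρ)
    (hgrad : ∀ y, ‖fderiv ℝ V y‖ ≤ K * Real.exp (B * (1 + ‖y‖) ^ σ)) {γ : ℝ} (hγ : 0 < γ) (R₀ : ℝ) :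
    ∃ R : ℝ, R₀ ≤ R ∧ ∀ y : EuclideanSpace ℝ (Fin 3), ‖y‖ = R → ¬ ⟪y, V y⟫ ≤ -(γ * ‖y‖ ^ 2) := by
  by_contra hcon
  push Not at hcon
  obtain ⟨L₀, hL₀, hgrow⟩ := gradient_growth_of_fastSpheres hρ hρ1 hC hV hA hE hγ hcon
  have hβ0 : 0 < 19 * π * γ ^ 2 / (51200 * (2 * ((c : ℝ) + 1) + 8 * C)) := by positivity
  have hK0 : 0 ≤ K := by
    have h := hgrad 0
    have he := Real.exp_pos (B * (1 + ‖(0 : EuclideanSpace ℝ (Fin 3))‖) ^ σ)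
    nlinarith [norm_nonneg (fderiv ℝ V 0)]
  have hθ : 0 < 2 + ρ - σ := by linarith
  -- choose `L`: `L ≥ L₀`, `L ≥ 1`, `β L^{2+ρ−σ} ≥ B·4^σ + |log(3(K+1)/γ)| + 1`
  have hev : ∀ᶠ L : ℝ in atTop, L₀ ≤ L ∧ 1 ≤ L ∧ B * 4 ^ σ + |Real.log (3 * (K + 1) / γ)| + 1 ≤
      19 * π * γ ^ 2 / (51200 * (2 * ((c : ℝ) + 1) + 8 * C)) * L ^ (2 + ρ - σ) :=
    (eventually_ge_atTop L₀).and ((eventually_ge_atTop 1).and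
      (((tendsto_rpow_atTop hθ).const_mul_atTop hβ0).eventually_ge_atTop _))
  obtain ⟨L, hLL₀, hL1, hM⟩ := hev.exists
  have hL0 : 0 < L := by linarith
  -- the gradient bound on `B_{3L}`
  have henv : ∀ x ∈ ball (0 : EuclideanSpace ℝ (Fin 3)) (3 * L),
      ‖fderiv ℝ V x‖ ≤ K * Real.exp (B * (4 * L) ^ σ) + 1 := by
    intro x hx
    rw [mem_ball_zero_iff] at hx
    have h1 : (1 + ‖x‖) ^ σ ≤ (4 * L) ^ σ := Real.rpow_le_rpow (by positivity) (by linarith) hσ0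
    have h2 : Real.exp (B * (1 + ‖x‖) ^ σ) ≤ Real.exp (B * (4 * L) ^ σ) :=
      Real.exp_le_exp.2 (mul_le_mul_of_nonneg_left h1 hB)
    have h3 := mul_le_mul_of_nonneg_left h2 hK0
    linarith [hgrad x]
  have hG0 : 0 < K * Real.exp (B * (4 * L) ^ σ) + 1 := by positivity
  have hgrowL := hgrow L hLL₀ _ hG0 henv
  -- the exponent splits: `βL^{2+ρ} − B(4L)^σ = L^σ (βL^{2+ρ−σ} − B4^σ) ≥ |log(3(K+1)/γ)| + 1`
  have hsplit : L ^ (2 + ρ) = L ^ σ * L ^ (2 + ρ - σ) := by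
    rw [← Real.rpow_add hL0]; ring_nf
  have h4 : (4 * L) ^ σ = 4 ^ σ * L ^ σ := Real.mul_rpow (by norm_num) hL0.le
  have hLσ : 1 ≤ L ^ σ := Real.one_le_rpow hL1 hσ0
  have hbr : |Real.log (3 * (K + 1) / γ)| + 1 ≤
      19 * π * γ ^ 2 / (51200 * (2 * ((c : ℝ) + 1) + 8 * C)) * L ^ (2 + ρ - σ) - B * 4 ^ σ := by linarith
  have hbr0 : 0 ≤ 19 * π * γ ^ 2 / (51200 * (2 * ((c : ℝ) + 1) + 8 * C)) * L ^ (2 + ρ - σ) - B * 4 ^ σ := by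
    linarith [abs_nonneg (Real.log (3 * (K + 1) / γ))]
  have hexpo : Real.log (3 * (K + 1) / γ) + 1 ≤
      19 * π * γ ^ 2 / (51200 * (2 * ((c : ℝ) + 1) + 8 * C)) * L ^ (2 + ρ) - B * (4 * L) ^ σ := by
    have h := mul_le_mul_of_nonneg_left hbr0 (by linarith : (0 : ℝ) ≤ L ^ σ - 1)
    rw [hsplit, h4]
    nlinarith [le_abs_self (Real.log (3 * (K + 1) / γ)), hbr, hLσ]
  -- whence `(γ/3) exp(βL^{2+ρ}) > (K+1) exp(B(4L)^σ) ≥ G`, contradicting the growth bound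
  have hq : 0 < 3 * (K + 1) / γ := by positivity
  have hkey : 3 * (K + 1) / γ * Real.exp (B * (4 * L) ^ σ) <
      Real.exp (19 * π * γ ^ 2 / (51200 * (2 * ((c : ℝ) + 1) + 8 * C)) * L ^ (2 + ρ)) := by
    have h1 : 3 * (K + 1) / γ < Real.exp (Real.log (3 * (K + 1) / γ) + 1) := by
      rw [Real.exp_add, Real.exp_log hq]
      have h3 : (1 : ℝ) < Real.exp 1 := by linarith [Real.exp_one_gt_d9]
      nlinarith
    calc 3 * (K + 1) / γ * Real.exp (B * (4 * L) ^ σ)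
        < Real.exp (Real.log (3 * (K + 1) / γ) + 1) * Real.exp (B * (4 * L) ^ σ) :=
          mul_lt_mul_of_pos_right h1 (Real.exp_pos _)
      _ ≤ Real.exp (19 * π * γ ^ 2 / (51200 * (2 * ((c : ℝ) + 1) + 8 * C)) * L ^ (2 + ρ) - B * (4 * L) ^ σ) *
            Real.exp (B * (4 * L) ^ σ) :=
          mul_le_mul_of_nonneg_right (Real.exp_le_exp.2 hexpo) (Real.exp_pos _).le
      _ = Real.exp (19 * π * γ ^ 2 / (51200 * (2 * ((c : ℝ) + 1) + 8 * C)) * L ^ (2 + ρ)) := by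
          rw [← Real.exp_add, sub_add_cancel]
  have hGle : K * Real.exp (B * (4 * L) ^ σ) + 1 ≤ (K + 1) * Real.exp (B * (4 * L) ^ σ) := by
    have h1 : 1 ≤ Real.exp (B * (4 * L) ^ σ) := Real.one_le_exp (by positivity)
    nlinarith
  have hmul := mul_lt_mul_of_pos_left hkey (by positivity : 0 < γ / 3)
  have hid : γ / 3 * (3 * (K + 1) / γ * Real.exp (B * (4 * L) ^ σ)) = (K + 1) * Real.exp (B * (4 * L) ^ σ) := by
    field_simp
  linarith

end Profile

/-! ## Member level -/

/-- **MEMBER LEVEL — gradient of exponential order `< 2+ρ` is a tame sub-stratum.**  In Seregin's power-gauged class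
(suitable weak solution on `ℝ³ × (−∞,0)` with weak spatial gradient `H` and the three power gauges
`a^{2ρ}A + a^ρE + a^{2ρ}D ≤ c`), exact self-similarity with `γ = 1/(2+ρ)`, `0 < ρ ≤ 1/2`, a `C²` velocity profile with
`‖∇V(y)‖ ≤ K·exp(B(1+‖y‖)^σ)`, `B ≥ 0`, `0 ≤ σ < 2+ρ` ⇒ `u = 0` a.e.: `exists_sphere_without_fast_point_of_expGradient`
(inputs `NeedleThinCore.selfSimilar_needle_inputs`) makes the sphere hypothesis of
`Loc.selfSimilar_ae_eq_zero_of_piercingIrrotationalC2_profile` hold vacuously.  Strictly contains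
`NeedleGradientGrowth.selfSimilar_ae_eq_zero_of_polyGradient`. [folklore] -/
theorem selfSimilar_ae_eq_zero_of_expGradient {ρ : ℝ} (hρ : 0 < ρ) (hρh : ρ ≤ 1 / 2)
    {u : ℝ → EuclideanSpace ℝ (Fin 3) → EuclideanSpace ℝ (Fin 3)} {p : ℝ → EuclideanSpace ℝ (Fin 3) → ℝ}
    {H : ℝ → EuclideanSpace ℝ (Fin 3) → EuclideanSpace ℝ (Fin 3) →L[ℝ] EuclideanSpace ℝ (Fin 3)} {c : ℝ≥0}
    (hsw : IsSuitableWeakSolutionOn (slab (EuclideanSpace ℝ (Fin 3)) (Iio 0) isOpen_Iio) 0 0 u p)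
    (hH : HasWeakSpatialGradientOn (slab (EuclideanSpace ℝ (Fin 3)) (Iio 0) isOpen_Iio) u H)
    (hgauge : ∀ a : ℝ, 0 < a →
      ENNReal.ofReal (a ^ (2 * ρ)) * cknA a (0 : ℝ × EuclideanSpace ℝ (Fin 3)) u +
          ENNReal.ofReal (a ^ ρ) * cknE a (0 : ℝ × EuclideanSpace ℝ (Fin 3)) H +
        ENNReal.ofReal (a ^ (2 * ρ)) * cknD a (0 : ℝ × EuclideanSpace ℝ (Fin 3)) p ≤ (c : ℝ≥0∞))
    {V : EuclideanSpace ℝ (Fin 3) → EuclideanSpace ℝ (Fin 3)} {P : EuclideanSpace ℝ (Fin 3) → ℝ}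
    (hu : ∀ τ : ℝ, τ < 0 → u τ = selfSimilarCollapse (1 / (2 + ρ)) 0 V τ)
    (hp : ∀ τ : ℝ, τ < 0 → p τ = selfSimilarCollapsePressure (1 / (2 + ρ)) 0 P τ)
    (hV : ContDiff ℝ 2 V) {K B σ : ℝ} (hB : 0 ≤ B) (hσ0 : 0 ≤ σ) (hσ : σ < 2 + ρ)
    (hgrad : ∀ y, ‖fderiv ℝ V y‖ ≤ K * Real.exp (B * (1 + ‖y‖) ^ σ)) :
    uncurry u =ᵐ[volume.restrict (Iio (0 : ℝ) ×ˢ (univ : Set (EuclideanSpace ℝ (Fin 3))))] 0 := by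
  have hρ1 : ρ < 1 := by linarith
  have hV1 : ContDiff ℝ 1 V := hV.of_le one_le_two
  obtain ⟨hA, hE⟩ := NeedleThinCore.selfSimilar_needle_inputs hρ hρ1 hsw hH hgauge hu hp hV1
  have hC : 0 < (1 - ρ) / (2 + ρ) * (c : ℝ) + 1 := by
    have h1 : 0 ≤ (1 - ρ) / (2 + ρ) := div_nonneg (by linarith) (by linarith)
    have h2 : 0 ≤ (1 - ρ) / (2 + ρ) * (c : ℝ) := mul_nonneg h1 (NNReal.coe_nonneg c)
    linarith
  have hE' : ∫⁻ y, ‖fderiv ℝ V y‖ₑ ^ 2 * ENNReal.ofReal (‖y‖ ^ (ρ - 1)) ≤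
      ENNReal.ofReal ((1 - ρ) / (2 + ρ) * (c : ℝ) + 1) :=
    hE.trans (ENNReal.ofReal_le_ofReal (by linarith))
  have hγ : (0 : ℝ) < 1 / (2 + ρ) := one_div_pos.2 (by linarith)
  refine Loc.selfSimilar_ae_eq_zero_of_piercingIrrotationalC2_profile hρ hρh hsw hgauge hu hp hV fun R₀ => ?_
  obtain ⟨R, hR, hnone⟩ :=
    exists_sphere_without_fast_point_of_expGradient hρ hρ1 hC hV1 hA hE' hB hσ0 hσ hgrad hγ R₀
  exact ⟨R, hR, fun y hy hf => absurd hf (hnone y hy)⟩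

end Summit.NavierStokesRegularity.NavierStokesRegularity.Theorems.PowerGaugeEulerLiouville.NeedleSphereGrowth
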